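import Literature.MathematicalPhysics.QuantumFieldTheory.Balaban1983to89.B9Eq360DeltaPrimeAY
import Literature.MathematicalPhysics.QuantumFieldTheory.Balaban1983to89.B9CubeLettersBondOpsL0

/-!
# `Balaban1983to89.B9Eq360DeltaPrimeACubeY` — (3.60) AT THE CUBE-LOCAL COVARIANT OPERATOR `Δ′_{a,□}(U)` OF [B9] SECT. C (p. 409; r05's
# `B9CubeLettersOpsL0.deltaPrimeACubeY`): the EXACT operator identity `Δ′_{a,□}(U′U) = Δ′_{a,□}(U) − V′(A′)` for `U′ = e^{iηA′}`, with r06's concrete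
# `V′(A′)` (`B9Eq360VprimeLetters.vPrimeConc`) written in THE CUBE SEQUENCE's averaging letters `kQCubeY sQCubeY kFCubeY sFCubeY cCubeY` — the cube twin
# of n06-c's `B9Eq360DeltaPrimeAY` (sub-row G-B9-LETTERS, module M5.1b-G′ «Cor 3.5∕3.6 for the site-sector cube letter G′_□», FILE 1)

T. Bałaban, *Propagators for lattice gauge theories in a background field*, Commun. Math. Phys. **99** (1985) 389–434
[`Balaban1985BackgroundPropagators`, "B9"]; [4] = T. Bałaban, *Propagators and renormalization transformations for lattice gauge
theories. II*, Commun. Math. Phys. **96** (1984) 223–250 [`Balaban1984PropagatorsII`].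

statement-level skeleton of published theorems with citation tags; proofs where landed; nothing here is a claim about the
Yang–Mills mass gap

THE PRINTED LOCUS (verbatim, held `paper:balaban1985-cmp99-background-propagators`, journal page = PDF page + 388; (3.60) is p. 402 l. 15–17, (3.53)–(3.54)
p. 400, (3.57) p. 401 foot, (3.58)–(3.59) p. 402 top with «F′\*_{2,j}(A) is not an adjoint of F′_{2,j}(A)» p. 402 l. 13–14 — page owner r06 g67, HOME∕INBOX
2026-08-28T10:46:38Z).  p. 402: *"Combining (3.53) and (3.59) we get Δ_{U′U} + Q′\*(U′U)aQ′(U′U) = Δ_U + Q′\*(U)aQ′(U) − V′₁(A) + F′₂\*(A)aQ′(U) + Q′\*(U)aF′₂(A) + F′₂\*(A)aF′₂(A) = Δ_U + Q′\*(U)aQ′(U) − V′(A),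
(3.60) where the operator V′(A) is defined by the last equality."*; (3.53) p. 400: *"Δ_{U′U} = Δ_U − V′₁(A)"*; (3.57) p. 401: *"Q′_j(U′U)λ = Q′_j(U)λ +
F′_{2,j}(A)λ"*; (3.59) p. 402: *"We have a similar expansion for the adjoint operator"*; (3.24) p. 394: *"Δ′_a = Δ′_a(U) = (Δ^η_U + Q′\*aQ′)|_{Ω₀}"*;
(3.19) p. 393: *"(Q′_j(U)λ)(y) = Σ_{x∈B^j(y)} L^{−jd} R(U(Γ^{(j)}_{y,x})) λ(x)"*; p. 407, Cor. 3.5: *"operators G′(U′), … defined for a sequence {Ω_j}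
… and for a field configuration U′ satisfying (3.37) with U = 1 … satisfy Theorems 3.1–3.3"*; p. 409 l. 1–5: *"the sequence {Ω_n(□)} satisfies the
assumptions of Corollary 3.6. The operators constructed for this sequence, which we denote by G′_□(U), C_□(U) = (Q′(U)G′_□²(U)Q′\*(U))⁻¹, G_□(U),
satisfy all the inequalities of Theorems 3.1–3.3 correspondingly."*

WHY THIS FILE (cell `lit-balaban`, sub-row G-B9-LETTERS of ROW G-B8-T2S, module-map `lit-balaban-r06/B9-LETTERS-MAP.md` §4∕§8: the site-sector half of
M5.1b `B9SectBStepAtCubeLetters` — Cor. 3.5∕3.6 for the cube letter `G′_□` — UNASSIGNED at 2026-08-28T10:13Z, OFFER∕INTENT of seat p33 gen 96, HOME∕INBOX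
2026-08-28T10:45:21Z).  The Sect.-B engine with the constants chosen before the lattice, `B9Thm34SectBUniformR1.thm34_Gp_uniform`, asks as its one
algebraic law that the instance's letter `Δ′_a(U′U)` EQUAL `Δ′_a(U) − conj b (vPrimeConc T U η A blk kQ kF sQ sF cfun)` — r06's CONCRETE `V′(A)` of (3.60)
in letters the instance supplies.  n06-c proved that law for NODE 00's torus operator `Node00.deltaPrimeAY i par U = lapSL i U + kernelTrOpY (avgCoeffY i)
(avgTrY i par U)` (`B9Eq360DeltaPrimeAY.eq360_deltaPrimeAY`, with the member's letters `kQY sQY cY kFY sFY` over the member's blocks `blkY`).  The cube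
letter of Sect. C in the cell's (R)-design is r05's `B9CubeLettersOpsL0.deltaPrimeACubeY i q par U = lapSL i U + kernelTrOpY (avgCoeffCubeY i q)
(avgTrCubeY i q par U)` — THE SAME SHAPE with the cube sequence's level function `levCubeY i q` (levels `min(D.lev, prof_□)`, `B9CubeSequence408`), its
weights `wCube` and its blocks `BlkCubeY i q` (`B9CubeLettersBondOpsL0`).  THIS FILE is the cube twin of n06-c's §2 and §4 (§1, §3, §5 of that file —
the adjoint-action letter `Rclm`, the additivity ∕ bilinear expansion of the block-model words, the Laplacian half (3.53) `lapSL_mulY_fluct`, the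
rescaling and the block relabelings — are USED BY NAME, being statements about NODE 00's Laplacian and r06's words, not about the level function):
* §1 THE CUBE SEQUENCE's AVERAGING LETTERS: the block map `blkCubeY i q` (site ↦ its block of `{Ω_n(□)}`), the kernel letter `kQCubeY par U s w :=
  W(s)⁻¹·R(U(Γ_{c_s,w}))` ((3.19) at the cube sequence's blocks, transport from the block's corner `c_s = blkCornerCubeY i q s` along `par`), the starred
  letter `sQCubeY par U z := R(U(Γ_{z,c_{s(z)}}))`, the weight letter `cCubeY s := levC_{j(s)}[wCube]·W(s)`; the dictionary `levCubeY_eq`,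
  `cornerY_levCubeY_eq` (the reference corner of r05's transporter `avgTrCubeY` IS the cube block's corner), `avgCoeffCubeY_eq_ite` (r05's coefficient is
  the cube block indicator times `levC`, as the `…L0` lineage's `B9Thm314GpFlatTorusGeometryL0.avgK_lev_eq` — re-proved in place to keep the import cone at r05's two files), and ★ `avgTermCube_eq_word`: r05's averaging term IS r06's word
  `L[sQCubeY]·diag(cCubeY)·K[kQCubeY]` (as `ℝ`-linear operators).
* §2 (3.60): the variation letters `kFCubeY := kQCubeY(U′U) − kQCubeY(U)`, `sFCubeY := sQCubeY(U′U) − sQCubeY(U)` ((3.57)∕(3.59) as DEFINITIONS —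
  print's `F′₂`, `F′₂\*` at the cube sequence's blocks; their (3.58) sizes are r05's `B9Eq357CubeLetters`, not this file), ★★ `deltaPrimeACubeY_mulY_fluct`:
  `Δ′_{a,□}(U′U) = Δ′_{a,□}(U) − (η²V′₁(A) − (F′₂\*aQ′ + Q′\*aF′₂ + F′₂\*aF′₂))` and ★★ `eq360_deltaPrimeACubeY`: the frames' shape
  `η⁻²Δ′_{a,□}(U′U) = η⁻²Δ′_{a,□}(U) − vPrimeConc (shiftY i) (UboxY i U) η (chartA i A′) blkCubeY kQCubeY kFCubeY sQCubeY sFCubeY (η⁻²·cCubeY)` (`η ≠ 0`) —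
  EXACTLY the `mul_law`-shaped hypothesis of `thm34_Gp_uniform` at `S := SiteY i`, `T := shiftY i`, base `U`, `blk := blkCubeY i q`.

HONEST SCOPE.  Exact finite-dimensional algebra about r05's DEFINED operator and r06's DEFINED letters, for EVERY configuration `U`, EVERY field `A′`,
EVERY site-transporter table `par` (so for def-Y's `parSymY` and for print's `parKnitY` alike); NO estimate ((3.58), (3.61) are not touched); nothing of
[B9] is asserted; COUNT-NEUTRAL; no summit ∕ sub-problem statement is proved; nothing continuum ∕ OS ∕ mass-gap ∕ Clay.  The (R)-design limits of the cube
letter (`B9CubeLettersOpsL0` HONEST SCOPE, `B9-LETTERS-MAP.md` §9 (a) Q1: the cube sequence realised on the member's own torus with a unit-mass floor in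
place of print's Dirichlet exterior; corner reference point; `par`'s contour) are inherited, not altered.  No `sorry`, no `axiom`, no `… : Prop` fact, no
`instance`, no `notation`.  NEW file; nothing landed is modified.  Cell `lit-balaban`, seat `lit-balaban-p33` gen 96, 2026-08-28; `--supports
stmt-QuantumFields-19200` as helper.  Net new unproved facts: 0.

RELATED IN THE TREE, NOT DUPLICATED (searched 2026-08-28: `rg deltaPrimeACubeY` = r05's `B9CubeLettersOpsL0` ∕ `B9CubeLettersCovarianceL0` ∕
`B9Thm311CubeLettersFirstThree` ∕ `B9CubeCutoffNearH`, none with (3.60); `ls | rg Eq360` = n06-c's member files + r06's letters): `B9Eq360DeltaPrimeAY`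
(`Rclm`, `word_sub_word_eq_avgOp`, `mulY`, `chartA`, `AfldY`, `lapSL_mulY_fluct`, `avgOp_smul_weight`), `B9Eq360Vprime` (`kerOp`, `liftOp`, `diagOp`,
`block`), `B9Eq360VprimeLetters` (`avgOp`, `vPrimeConc`, `vPrimeConc_eq`), `B9CubeLettersOpsL0` (`cubeFamY`, `levCubeY`, `avgCoeffCubeY`, `avgTrCubeY`,
`deltaPrimeACubeY`), `B9CubeLettersBondOpsL0` (`BlkCubeY`, `blkCornerCubeY`), `B6Ineq268MultiLevelBoxL0.W`,
`B6Geom246MultiLevelBoxL0` (`blkOf`, `lev_eq_of_blkOf_eq`) — USED BY NAME; no existing module modified.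
-/

noncomputable section

namespace Literature.MathematicalPhysics.QuantumFieldTheory.Balaban1983to89.B9Eq360DeltaPrimeACubeY

open Literature.MathematicalPhysics.QuantumFieldTheory.Balaban1983to89.B9Eq39Adjoint (R R_smul fluct)
open Literature.MathematicalPhysics.QuantumFieldTheory.Balaban1983to89.B9Eq352GradLetters (V1pOp)
open Literature.MathematicalPhysics.QuantumFieldTheory.Balaban1983to89.B9Eq360Vprime (kerOp liftOp diagOp kerOp_apply liftOp_apply diagOp_apply)
open Literature.MathematicalPhysics.QuantumFieldTheory.Balaban1983to89.B9Eq360VprimeLetters (vPrimeConc vPrimeConc_eq)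
open Literature.MathematicalPhysics.QuantumFieldTheory.Balaban1983to89.B9Eq360DeltaPrimeAY (Rclm Rclm_apply word_sub_word_eq_avgOp mulY chartA AfldY
  lapSL_mulY_fluct avgOp_smul_weight)
open Literature.MathematicalPhysics.QuantumFieldTheory.Balaban1983to89.B6KLevelCensusIndexV1 (KIdx)
open Literature.MathematicalPhysics.QuantumFieldTheory.Balaban1983to89.B6Cover236MultiLevelBlocks (cubes)
open Literature.MathematicalPhysics.QuantumFieldTheory.Balaban1983to89.B6Geom246MultiLevelBoxL0 (blkOf blkOf_eq_iff_blk lev_eq_of_blkOf_eq)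
open Literature.MathematicalPhysics.QuantumFieldTheory.Balaban1983to89.B4Reflection242 (avgK blk)
open Literature.MathematicalPhysics.QuantumFieldTheory.Balaban1983to89.B6Ineq268MultiLevelBoxL0 (W W_pos)
open Literature.MathematicalPhysics.QuantumFieldTheory.Balaban1983to89.B6MultiLevelBoxOperator (levC)
open Literature.MathematicalPhysics.QuantumFieldTheory.Balaban1983to89.B9Thm31CubeLocalFlat (wCube)
open Literature.MathematicalPhysics.QuantumFieldTheory.Balaban1983to89.B9CubeLettersOpsL0 (cubeFamY levCubeY avgCoeffCubeY avgTrCubeY deltaPrimeACubeY)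
open Literature.MathematicalPhysics.QuantumFieldTheory.Balaban1983to89.B9CubeLettersBondOpsL0 (BlkCubeY blkCornerCubeY)
open Literature.MathematicalPhysics.QuantumFieldTheory.Balaban1983to89.Node00 (SiteY CfgY SiteParY UboxY shiftY lapSL kernelTrOpY kernelTrOpY_apply cornerY
  toKT)

variable {d ℓ : ℕ} {hd : 1 ≤ d + 1} {hL : Odd (ℓ + 1) ∧ 1 < ℓ + 1} {b₀ b₁ : ℝ}
variable {𝔸 : Type} [NormedRing 𝔸] [NormedAlgebra ℂ 𝔸] [CompleteSpace 𝔸]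

/-! ## §1 The cube sequence's averaging term `Q′*_□(U)·a·Q′_□(U)` in r06's block model: the letters `kQCubeY sQCubeY cCubeY` -/

section Letters

variable (i : KIdx d ℓ hd hL b₀ b₁) (q : ↥(cubes (toKT i).D.toDomains)) (par : SiteParY 𝔸 i)

/-- the block map of THE CUBE SEQUENCE `{Ω_n(□)}`: the block of its multilevel partition containing a site of the member's torus (levels
`min(D.lev, prof_□)`; unit cubes on its floor). [cite: Balaban1985BackgroundPropagators, p.408 («a sequence {Ω_n(□)}»), p.397 («y ∈ 𝔅 = ⋃_j Λ_j … Δ(y) = B^j(y)»), dictionary] -/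
def blkCubeY : SiteY i → BlkCubeY i q := fun z => blkOf (cubeFamY i q).toDomains z

omit [NormedRing 𝔸] [NormedAlgebra ℂ 𝔸] [CompleteSpace 𝔸] in
/-- `blkCubeY`, evaluated. [cite: Balaban1985BackgroundPropagators, p.408, bookkeeping] -/
@[simp] theorem blkCubeY_apply (z : SiteY i) : blkCubeY i q z = blkOf (cubeFamY i q).toDomains z := rfl

omit [NormedRing 𝔸] [NormedAlgebra ℂ 𝔸] [CompleteSpace 𝔸] in
/-- the cube sequence's level of a site is the level of its cube block. [cite: Balaban1985BackgroundPropagators, p.408; Balaban1984PropagatorsII, (2.3)–(2.4) p.224, bookkeeping] -/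
theorem levCubeY_eq (z : SiteY i) : levCubeY i q z = (blkCubeY i q z).1.1 := by
  change (cubeFamY i q).toDomains.lev z.1 = (blkCubeY i q z).1.1
  exact lev_eq_of_blkOf_eq (cubeFamY i q).toDomains rfl

omit [NormedRing 𝔸] [NormedAlgebra ℂ 𝔸] [CompleteSpace 𝔸] in
/-- the reference corner of r05's averaging transporter `avgTrCubeY` (NODE 00's `cornerY` at the cube level) IS the corner of the cube block containing
the site. [cite: Balaban1985BackgroundPropagators, (3.19) p.393, (3.21) p.394, dictionary] -/
theorem cornerY_levCubeY_eq (z : SiteY i) : cornerY i (levCubeY i q z) z = blkCornerCubeY i q (blkCubeY i q z) :=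
  Subtype.ext (funext fun _ => rfl)

omit [NormedRing 𝔸] [NormedAlgebra ℂ 𝔸] [CompleteSpace 𝔸] in
/-- r05's averaging coefficient of the cube sequence is the cube block indicator: `levC_{lev_□ z}[wCube]·[blkCubeY w = blkCubeY z]` (the `…L0`
lineage's `B9Thm314GpFlatTorusGeometryL0.avgK_lev_eq` at the cube family, three lines re-proved to spare the import). [cite: Balaban1984PropagatorsII, (2.14) p.225; Balaban1985BackgroundPropagators, (3.24) p.394, p.409, dictionary] -/
theorem avgCoeffCubeY_eq_ite (z w : SiteY i) :
    avgCoeffCubeY i q z w = if blkCubeY i q w = blkCubeY i q z then levC d ℓ (wCube ℓ) (levCubeY i q z) else 0 := by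
  unfold avgCoeffCubeY avgK
  have e : (blk ((ℓ + 1) ^ levCubeY i q z) w.1 = blk ((ℓ + 1) ^ levCubeY i q z) z.1) ↔ blkCubeY i q w = blkCubeY i q z := by
    rw [blkCubeY_apply, blkCubeY_apply, blkOf_eq_iff_blk (cubeFamY i q).toDomains]; rfl
  by_cases h : blk ((ℓ + 1) ^ levCubeY i q z) w.1 = blk ((ℓ + 1) ^ levCubeY i q z) z.1
  · rw [if_pos h, if_pos (e.1 h)]
  · rw [if_neg h, if_neg (fun h' => h (e.2 h'))]

/-- **the kernel letter of `Q′_□(U)`** in r06's block model ((3.19) at the cube sequence's blocks): `kQ(s, w) = W(s)⁻¹ · R(U(Γ_{c_s, w}))` — cube block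
volume `W(s)`, contour from the cube block's corner `c_s` (`blkCornerCubeY`) along the transporter table `par` (the transporter of r05's `QpCubeY`,
`B9CubeLettersBondOpsL0.qpTc`). [cite: Balaban1985BackgroundPropagators, (3.19) p.393, (3.21) p.394, p.409] -/
def kQCubeY (U : CfgY 𝔸 i) : BlkCubeY i q → SiteY i → 𝔸 →L[ℝ] 𝔸 := fun s w => (W (cubeFamY i q).toDomains s)⁻¹ • Rclm (par U (blkCornerCubeY i q s) w)

/-- **the letter of `Q′*_□(U)`** in r06's block model: `sQ(z) = R(U(Γ_{z, c_{s(z)}}))` (transport from the corner of the cube block of `z` to `z`).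
[cite: Balaban1985BackgroundPropagators, (3.24) p.394 (Q′*), (3.19) p.393, p.409] -/
def sQCubeY (U : CfgY 𝔸 i) : SiteY i → 𝔸 →L[ℝ] 𝔸 := fun z => Rclm (par U z (blkCornerCubeY i q (blkCubeY i q z)))

/-- **the weight letter `a` per block of the cube sequence, lattice units**: `c(s) = levC_{j(s)}[wCube]·W(s)` (r05's collapsed coefficient of `Q′*aQ′`
at the cube family — `a = 1` on the floor, print's `a_j` at a level `j ≥ 1` — times the block volume).
[cite: Balaban1985BackgroundPropagators, (3.24) p.394, p.409; Balaban1984PropagatorsII, (2.14) p.225] -/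
def cCubeY : BlkCubeY i q → ℝ := fun s => levC d ℓ (wCube ℓ) s.1.1 * W (cubeFamY i q).toDomains s

/-- `kQ(s, w)` applied. [cite: Balaban1985BackgroundPropagators, (3.19) p.393, bookkeeping] -/
@[simp] theorem kQCubeY_apply (U : CfgY 𝔸 i) (s : BlkCubeY i q) (w : SiteY i) (X : 𝔸) :
    kQCubeY i q par U s w X = (W (cubeFamY i q).toDomains s)⁻¹ • R (par U (blkCornerCubeY i q s) w) X := by
  simp [kQCubeY]

/-- `sQ(z)` applied. [cite: Balaban1985BackgroundPropagators, (3.24) p.394, bookkeeping] -/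
@[simp] theorem sQCubeY_apply (U : CfgY 𝔸 i) (z : SiteY i) (X : 𝔸) :
    sQCubeY i q par U z X = R (par U z (blkCornerCubeY i q (blkCubeY i q z))) X := by
  simp [sQCubeY]

/-- ★ **r05's AVERAGING TERM OF THE CUBE SEQUENCE IS r06's WORD `Q′*_□(U)·a·Q′_□(U)`**:
`Σ_w avgCoeffCubeY(z,w)·R(U(Γ_{z,c})U(Γ_{c,w}))Φ(w) = (L[sQ]·a·K[kQ] Φ)(z)` — the transported collapsed kernel of `B9CubeLettersOpsL0.deltaPrimeACubeY`
read in the block model of `B9Eq360Vprime` with the letters `kQCubeY`, `sQCubeY`, `cCubeY` over the cube blocks `blkCubeY` (as `ℝ`-linear operators).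
[cite: Balaban1985BackgroundPropagators, (3.19) p.393, (3.24) p.394, p.409 l.1–5; Balaban1984PropagatorsII, (2.13)–(2.14) p.225] -/
theorem avgTermCube_eq_word (U : CfgY 𝔸 i) :
    (kernelTrOpY (avgCoeffCubeY i q) (avgTrCubeY i q par U)).restrictScalars ℝ
      = liftOp (blkCubeY i q) (sQCubeY i q par U) ∘ₗ diagOp (cCubeY i q) ∘ₗ kerOp (blkCubeY i q) (kQCubeY i q par U) := by
  refine LinearMap.ext fun Φ => funext fun z => ?_
  set s : BlkCubeY i q := blkCubeY i q z with hs
  have hlev : levCubeY i q z = s.1.1 := levCubeY_eq i q z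
  have hcorner : cornerY i (levCubeY i q z) z = blkCornerCubeY i q s := cornerY_levCubeY_eq i q z
  have hcoef : ∀ w : SiteY i, avgCoeffCubeY i q z w = if blkCubeY i q w = s then levC d ℓ (wCube ℓ) s.1.1 else 0 := fun w => by
    rw [avgCoeffCubeY_eq_ite, hlev]
  -- the right-hand side, unfolded at `z`: `sQ(z)(c(s) • Σ_{w∈s} kQ(s,w)Φ(w))`
  show kernelTrOpY (avgCoeffCubeY i q) (avgTrCubeY i q par U) Φ z
    = sQCubeY i q par U z (cCubeY i q s • ∑ w ∈ B9Eq360Vprime.block (blkCubeY i q) s, kQCubeY i q par U s w (Φ w))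
  have hR : ∀ (u : 𝔸ˣ) (f : SiteY i → 𝔸), R u (∑ w ∈ B9Eq360Vprime.block (blkCubeY i q) s, f w)
      = ∑ w ∈ B9Eq360Vprime.block (blkCubeY i q) s, R u (f w) :=
    fun u f => map_sum (Node00.RL u) f _
  rw [kernelTrOpY_apply, sQCubeY_apply, ← hs]
  calc ∑ w, ((avgCoeffCubeY i q z w : ℝ) : ℂ) • R (avgTrCubeY i q par U z w) (Φ w)
      = ∑ w, if blkCubeY i q w = s then
          ((levC d ℓ (wCube ℓ) s.1.1 : ℝ) : ℂ) • R (par U z (blkCornerCubeY i q s)) (R (par U (blkCornerCubeY i q s) w) (Φ w)) else 0 := by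
        refine Finset.sum_congr rfl fun w _ => ?_
        rw [hcoef, avgTrCubeY, hcorner, B9Eq39Adjoint.R_mul]
        split_ifs
        · rfl
        · rw [Complex.ofReal_zero, zero_smul]
    _ = ∑ w ∈ B9Eq360Vprime.block (blkCubeY i q) s,
          ((levC d ℓ (wCube ℓ) s.1.1 : ℝ) : ℂ) • R (par U z (blkCornerCubeY i q s)) (R (par U (blkCornerCubeY i q s) w) (Φ w)) := by
        rw [B9Eq360Vprime.block, Finset.sum_filter]
    _ = R (par U z (blkCornerCubeY i q s)) (cCubeY i q s • ∑ w ∈ B9Eq360Vprime.block (blkCubeY i q) s, kQCubeY i q par U s w (Φ w)) := by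
        rw [R_smul, hR, Finset.smul_sum]
        refine Finset.sum_congr rfl fun w _ => ?_
        simp only [kQCubeY_apply, R_smul, smul_smul, cCubeY, mul_assoc, mul_inv_cancel₀ (W_pos (cubeFamY i q).toDomains s).ne', mul_one,
          Complex.coe_smul]

end Letters

/-! ## §2 ★★ (3.60) for r05's cube letter `Δ′_{a,□}(U)` -/

section Main

variable (i : KIdx d ℓ hd hL b₀ b₁) (q : ↥(cubes (toKT i).D.toDomains)) (par : SiteParY 𝔸 i)

/-- **the variation letter `F′₂(A′)` of `Q′_□`** ((3.57): `Q′_□(U′U) = Q′_□(U) + F′₂(A′)`), in r06's block model: `kF := kQ(U′U) − kQ(U)` at the cube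
sequence's blocks (its (3.58) size is r05's `B9Eq357CubeLetters.norm_kernelLetter_QpCubeY_mul_sub_le`, not this file).
[cite: Balaban1985BackgroundPropagators, (3.57)–(3.58) pp.401–402, p.409] -/
def kFCubeY (U U'U : CfgY 𝔸 i) : BlkCubeY i q → SiteY i → 𝔸 →L[ℝ] 𝔸 := fun s w => kQCubeY i q par U'U s w - kQCubeY i q par U s w

/-- **the variation letter `F′₂*(A′)` of `Q′*_□`** ((3.59) «a similar expansion for the adjoint operator»): `sF := sQ(U′U) − sQ(U)`.
[cite: Balaban1985BackgroundPropagators, (3.59) p.402, p.409] -/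
def sFCubeY (U U'U : CfgY 𝔸 i) : SiteY i → 𝔸 →L[ℝ] 𝔸 := fun z => sQCubeY i q par U'U z - sQCubeY i q par U z

/-- (3.57) for the kernel letter: `kQ(U′U) = kQ(U) + kF`. [cite: Balaban1985BackgroundPropagators, (3.57) p.401, bookkeeping] -/
theorem kQCubeY_eq_add (U U'U : CfgY 𝔸 i) : kQCubeY i q par U'U = kQCubeY i q par U + kFCubeY i q par U U'U := by
  funext s w; simp [kFCubeY]

/-- (3.59) for the starred letter: `sQ(U′U) = sQ(U) + sF`. [cite: Balaban1985BackgroundPropagators, (3.59) p.402, bookkeeping] -/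
theorem sQCubeY_eq_add (U U'U : CfgY 𝔸 i) : sQCubeY i q par U'U = sQCubeY i q par U + sFCubeY i q par U U'U := by
  funext z; simp [sFCubeY]

/-- ★★ **(3.60) FOR r05's CUBE LETTER `Δ′_{a,□}(U)`, EXACTLY, lattice units** (`U′ = e^{iηA′}`, `η ≠ 0`, ANY `U`, ANY `A′`, any transporter table `par`):
`Δ′_{a,□}(U′U) = Δ′_{a,□}(U) − (η²·V′₁(A) − (F′₂*aQ′_□(U) + Q′*_□(U)aF′₂ + F′₂*aF′₂))` as `ℝ`-linear operators on NODE 00's site carrier, with r06's CONCRETE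
`V′₁(A) = B9Eq352GradLetters.V1pOp (shiftY i) (UboxY i U) η (chartA i A′)` of (3.52) and the averaging words `B9Eq360VprimeLetters.avgOp` in the cube letters
`kQCubeY`, `kFCubeY`, `sQCubeY`, `sFCubeY`, `cCubeY` — print's *"Combining (3.53) and (3.59) we get … = Δ_U + Q′\*(U)aQ′(U) − V′(A) (3.60)"* for the operator
«constructed for the sequence {Ω_n(□)}» (p. 409). [cite: Balaban1985BackgroundPropagators, (3.60) p.402, (3.53) p.400, (3.57)–(3.59) pp.401–402, (3.24) p.394, p.409 l.1–5] -/
theorem deltaPrimeACubeY_mulY_fluct {η : ℝ} (hη : η ≠ 0) (A' : AfldY 𝔸 i) (U : CfgY 𝔸 i) :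
    (deltaPrimeACubeY i q par (mulY i (fluct η A') U)).restrictScalars ℝ
      = (deltaPrimeACubeY i q par U).restrictScalars ℝ
        - ((η ^ 2 : ℝ) • V1pOp (shiftY i) (UboxY i U) η (chartA i A')
          - B9Eq360VprimeLetters.avgOp (blkCubeY i q) (kQCubeY i q par U) (kFCubeY i q par U (mulY i (fluct η A') U)) (sQCubeY i q par U)
              (sFCubeY i q par U (mulY i (fluct η A') U)) (cCubeY i q)) := by
  rw [deltaPrimeACubeY, deltaPrimeACubeY, LinearMap.restrictScalars_add, LinearMap.restrictScalars_add, lapSL_mulY_fluct i hη,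
    avgTermCube_eq_word, avgTermCube_eq_word, kQCubeY_eq_add i q par U (mulY i (fluct η A') U), sQCubeY_eq_add i q par U (mulY i (fluct η A') U),
    ← word_sub_word_eq_avgOp]
  abel

/-- ★★ **(3.60) AT THE CUBE LETTER IN THE SHAPE OF THE SECT.-B ENGINE** (the `mul_law`-shaped hypothesis of `B9Thm34SectBUniformR1.thm34_Gp_uniform`:
`Δp(U′U) = Δp(U) − V′`): with the `η⁻²`-RESCALED letter `Δp(V) := η⁻²·Δ′_{a,□}(V)` (print's units) and the rescaled weight `η⁻²·cCubeY`,
`η⁻²·Δ′_{a,□}(U′U) = η⁻²·Δ′_{a,□}(U) − vPrimeConc (shiftY i) (UboxY i U) η (chartA i A′) blkCubeY kQCubeY kFCubeY sQCubeY sFCubeY (η⁻²·cCubeY)`.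
[cite: Balaban1985BackgroundPropagators, (3.60) p.402, (3.24) p.394, Cor. 3.5 p.407, p.409 l.1–5] -/
theorem eq360_deltaPrimeACubeY {η : ℝ} (hη : η ≠ 0) (A' : AfldY 𝔸 i) (U : CfgY 𝔸 i) :
    (η ^ 2)⁻¹ • (deltaPrimeACubeY i q par (mulY i (fluct η A') U)).restrictScalars ℝ
      = (η ^ 2)⁻¹ • (deltaPrimeACubeY i q par U).restrictScalars ℝ
        - vPrimeConc (shiftY i) (UboxY i U) η (chartA i A') (blkCubeY i q) (kQCubeY i q par U) (kFCubeY i q par U (mulY i (fluct η A') U))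
            (sQCubeY i q par U) (sFCubeY i q par U (mulY i (fluct η A') U)) ((η ^ 2)⁻¹ • cCubeY i q) := by
  have hη2 : (η ^ 2 : ℝ) ≠ 0 := pow_ne_zero 2 hη
  rw [deltaPrimeACubeY_mulY_fluct i q par hη, vPrimeConc_eq, avgOp_smul_weight, smul_sub, smul_sub, smul_smul, inv_mul_cancel₀ hη2, one_smul]

/-- ★★ **(3.60) AT THE CUBE LETTER, BASE `U = 1`** (the case Cor. 3.5 uses: *«U′ satisfying (3.37) with U = 1»*, p. 407; on the cube road `U′ = U^u` after
the (3.35) gauge, p. 408): `η⁻²·Δ′_{a,□}(U′·1) = η⁻²·Δ′_{a,□}(1) − V′(A′)` with the letters read at the trivial configuration.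
[cite: Balaban1985BackgroundPropagators, Cor. 3.5 p.407, (3.60) p.402, p.408 l.11–14, p.409 l.1–5] -/
theorem eq360_deltaPrimeACubeY_one {η : ℝ} (hη : η ≠ 0) (A' : AfldY 𝔸 i) :
    (η ^ 2)⁻¹ • (deltaPrimeACubeY i q par (mulY i (fluct η A') (fun _ _ => 1))).restrictScalars ℝ
      = (η ^ 2)⁻¹ • (deltaPrimeACubeY i q par (fun _ _ => 1)).restrictScalars ℝ
        - vPrimeConc (shiftY i) (UboxY i (fun _ _ => (1 : 𝔸ˣ))) η (chartA i A') (blkCubeY i q) (kQCubeY i q par (fun _ _ => 1))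
            (kFCubeY i q par (fun _ _ => 1) (mulY i (fluct η A') (fun _ _ => 1))) (sQCubeY i q par (fun _ _ => 1))
            (sFCubeY i q par (fun _ _ => 1) (mulY i (fluct η A') (fun _ _ => 1))) ((η ^ 2)⁻¹ • cCubeY i q) :=
  eq360_deltaPrimeACubeY i q par hη A' _

end Main

end Literature.MathematicalPhysics.QuantumFieldTheory.Balaban1983to89.B9Eq360DeltaPrimeACubeY

end
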